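import Summits.Ventures.CertifiedArithmetic.LowPrec.SRPythagorasDrift
import HarnessLib

/-!
# Stochastic rounding in low-precision formats XCIII — truncation rules (IEEE P3109 StochasticA,
# `SR_{p,r}`) are DRIFT-ANTITONE across a binade boundary, so the Pythagorean MSE law holds there for
# every `n`; StochasticB breaks it (kernel-level dichotomy with file XCII)

HONEST FRAMING: certified error envelopes and provably optimal rounding/accumulation schemes for
low-precision formats under stated cost models; every table by two implementations; no hardware or
vendor claims.

XCII (`SRPythagorasDrift`) reduced `E(ŝₙ − sₙ)² ≤ n·G²/4 + (n·ε·G)²` to DRIFT-ANTITONICITY of the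
outcome tree and showed `SR_ε`, StochasticB (one bit) and a non-monotone rule violate it on one-signed
windows across a binade boundary, StochasticA being certified there instance by instance only.  Settled
here for StochasticA with `N + 1 ≥ 1` random bits (away-probability `⌊2^{N+1}θ⌋/2^{N+1}`; `SR_{p,r}`):
* `LimitedBits.TwoBlockWindow F lo B hi g`: `F ∩ [lo, hi]` has spacing `g` on `[lo, B]`, `2g` on
  `[B, hi]`, all points on `lo + gℤ` (three finitely checkable clauses);
* `TwoBlockWindow.stepQA_eq/stepQA_lever` (the lever): the step mean is `τ(c) = c − ((c − lo) mod ρ)`,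
  `ρ = g/2^{N+1}` at or below `B` and `g/2^N` above, whence `0 ≤ τ(c') − τ(c) ≤ c' − c` for window
  points `c ≤ c'`, `c' − c ∈ gℤ` — a residue only GROWS when read in the coarser block
  (`y mod ρ ≤ y mod 2ρ ≤ y mod ρ + ρ`; this is where `N + 1 ≥ 1` is needed);
* `accExpQA_contract` (the `n`-step mean is `1`-Lipschitz on grid points, induction over the tree) ⇒
  `driftAntitone_stochasticA` ⇒ `stochasticA_acc_sq_le`: `E(ŝₙ − sₙ)² ≤ n·(2g)²/4 + (n·2g/2^{N+1})²`
  for EVERY `n` (`G = 2g`, `ε = 2^{-(N+1)}`); `Formats.e3m2_binade_dichotomy`: on E3M2 `[6, 14]` this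
  holds while StochasticB (one bit) fails at `n = 4`; `Formats.e2m3_stochasticA_binade_law` likewise on
  the window of XCII's `SR_{1/4}` violation.
Scope (honest): ONE boundary, one-signed windows; across two boundaries one bit does not give
antitonicity (`Formats.e3m2_threeBinade_A1_not`; two bits do there), though no StochasticA violation of
the law is known (sr-seat certificate gen16/pyth, evidence only).  Prior art: [ElararEtAl2025, Thm. 3–4]
(`SR_{p,r}` to first order, relative model); [XiaEtAl2022]; IEEE P3109.  No Mathlib precedent.
-/

namespace Summit.Ventures.CertifiedArithmetic.LowPrec.SR

open Literature.ComputerArithmetic.ConnollyHighamMary2021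
open Finset

variable {K : Type*} [Field K] [LinearOrder K] [IsStrictOrderedRing K] [FloorRing K]

namespace LimitedBits

/-! ### Residues modulo a sub-quantum -/

/-- `resid y ρ = y mod ρ` (`= y − ρ⌊y/ρ⌋`; junk value `y` for `ρ = 0`). -/
def resid (y ρ : K) : K := y - ρ * ⌊y / ρ⌋

/-- Shift invariance: `(y + kρ) mod ρ = y mod ρ`. -/
theorem resid_add_mul {y ρ : K} (hρ : 0 < ρ) (k : ℤ) : resid (y + k * ρ) ρ = resid y ρ := by
  unfold resid
  rw [show (y + k * ρ) / ρ = y / ρ + k by rw [add_div, mul_div_cancel_right₀ _ hρ.ne'],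
    Int.floor_add_intCast]
  push_cast; ring

/-- Nested sub-quanta: reading the same offset in a cell twice as coarse can only increase the
residue, by at most `ρ`: `y mod ρ ≤ y mod 2ρ ≤ y mod ρ + ρ`. -/
theorem resid_two_mul {y ρ : K} (hρ : 0 < ρ) :
    resid y ρ ≤ resid y (2 * ρ) ∧ resid y (2 * ρ) ≤ resid y ρ + ρ := by
  unfold resid
  have hρ0 : ρ ≠ 0 := hρ.ne'
  have e : y / ρ = 2 * (y / (2 * ρ)) := by field_simp
  have h1 := Int.floor_le (y / (2 * ρ))
  have h2 := Int.lt_floor_add_one (y / (2 * ρ))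
  have k1 : 2 * ⌊y / (2 * ρ)⌋ ≤ ⌊y / ρ⌋ := by rw [Int.le_floor]; push_cast; rw [e]; linarith
  have k2 : ⌊y / ρ⌋ < 2 * ⌊y / (2 * ρ)⌋ + 2 := by rw [Int.floor_lt]; push_cast; rw [e]; linarith
  have k1' : 2 * (⌊y / (2 * ρ)⌋ : K) ≤ (⌊y / ρ⌋ : K) := by exact_mod_cast k1
  have k2' : (⌊y / ρ⌋ : K) ≤ 2 * (⌊y / (2 * ρ)⌋ : K) + 1 := by
    exact_mod_cast (show ⌊y / ρ⌋ ≤ 2 * ⌊y / (2 * ρ)⌋ + 1 by omega)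
  constructor <;>
    linarith [mul_le_mul_of_nonneg_left k1' hρ.le, mul_le_mul_of_nonneg_left k2' hρ.le]

/-! ### The truncation step on one cell -/

/-- **StochasticA on a cell.**  On a nonnegative cell that is degenerate or of width `2^N·ρ`, the
one-step mean of StochasticA with `N` random bits is `c` minus the truncated residue
`(c − ⌊c̄⌋) mod ρ`. -/
theorem stepQA_cell (F : Finset K) (N : ℕ) {c ρ : K} (hc : InHull F c) (hd : 0 ≤ dn F c)
    (hρ : 0 < ρ) (hw : up F c = dn F c ∨ up F c = dn F c + 2 ^ N * ρ) :
    stepQ F (probAwayA N) c (fun y => y) = c - resid (c - dn F c) ρ := by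
  have hdc : dn F c ≤ c := by unfold dn; rw [clamp_eq_self hc]; exact roundDown_le F c
  have hcu : c ≤ up F c := by unfold up; rw [clamp_eq_self hc]; exact le_roundUp F c
  have hp : pUp F c = (c - dn F c) / (up F c - dn F c) := by
    unfold pUp probUp up dn; rw [clamp_eq_self hc]
  unfold stepQ pUpQ
  rw [if_pos hd]
  rcases hw with h0 | h1
  · have hcd : c = dn F c := le_antisymm (h0 ▸ hcu) hdc
    have r0 : resid (0 : K) ρ = 0 := by simp [resid]
    rw [h0, ← hcd, sub_self, r0]; ring
  · have hρ0 : ρ ≠ 0 := hρ.ne'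
    have hw' : up F c - dn F c = 2 ^ N * ρ := by rw [h1]; ring
    rw [hp, hw', h1]
    have e : (c - dn F c) / (2 ^ N * ρ) * 2 ^ N = (c - dn F c) / ρ := by
      field_simp
    unfold probAwayA resid
    rw [e]
    generalize ⌊(c - dn F c) / ρ⌋ = f
    field_simp
    ring

/-! ### Two-block windows (one binade boundary) -/

/-- `TwoBlockWindow F lo B hi g`: `F ∩ [lo, hi] = {lo, lo + g, …, B} ∪ {B, B + 2g, …, hi}` — equally
spaced with spacing `g` below the binade boundary `B` and `2g` above it — and every point of the window
lies on the grid `lo + g·ℤ` (three finitely checkable clauses). -/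
structure TwoBlockWindow (F : Finset K) (lo B hi g : K) : Prop where
  fine : UniformWindow F lo B g
  coarse : UniformWindow F B hi (2 * g)
  grid : ∀ a ∈ F, lo ≤ a → a ≤ hi → a - lo = ⌊(a - lo) / g⌋ * g

namespace TwoBlockWindow

variable {F : Finset K} {lo B hi g : K}

omit [IsStrictOrderedRing K] in
/-- The fine spacing is positive. -/
theorem pos (hW : TwoBlockWindow F lo B hi g) : 0 < g := hW.fine.pos

omit [IsStrictOrderedRing K] in
/-- Window points lie in the hull of `F`. -/
theorem inHull (hW : TwoBlockWindow F lo B hi g) {c : K} (h1 : lo ≤ c) (h2 : c ≤ hi) : InHull F c :=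
  ⟨⟨lo, hW.fine.lo_mem, h1⟩, ⟨hi, hW.coarse.hi_mem, h2⟩⟩

omit [IsStrictOrderedRing K] in
/-- The candidates of a window point: format values inside the window, bracketing the point. -/
theorem cand (hW : TwoBlockWindow F lo B hi g) {c : K} (h1 : lo ≤ c) (h2 : c ≤ hi) :
    dn F c ∈ F ∧ up F c ∈ F ∧ lo ≤ dn F c ∧ up F c ≤ hi ∧ dn F c ≤ c ∧ c ≤ up F c := by
  have hcl := clamp_eq_self (hW.inHull h1 h2)
  unfold dn up; rw [hcl]
  exact ⟨roundDown_mem ⟨lo, hW.fine.lo_mem, h1⟩, roundUp_mem ⟨hi, hW.coarse.hi_mem, h2⟩,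
    le_roundDown_of_mem hW.fine.lo_mem h1, roundUp_le_of_mem hW.coarse.hi_mem h2, roundDown_le F c,
    le_roundUp F c⟩

/-- Every cell of the window is degenerate, of width `g` (at or below `B`) or of width `2g` (above). -/
theorem up_eq_or (hW : TwoBlockWindow F lo B hi g) {c : K} (h1 : lo ≤ c) (h2 : c ≤ hi) :
    up F c = dn F c ∨ (c ≤ B ∧ up F c = dn F c + g) ∨ (B < c ∧ up F c = dn F c + 2 * g) := by
  have hcl := clamp_eq_self (hW.inHull h1 h2)
  unfold up dn; rw [hcl]
  by_cases hcB : c ≤ B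
  · rcases hW.fine.roundUp_eq_or h1 hcB with h | h
    · exact Or.inl h
    · exact Or.inr (Or.inl ⟨hcB, h⟩)
  · rcases hW.coarse.roundUp_eq_or (not_le.mp hcB).le h2 with h | h
    · exact Or.inl h
    · exact Or.inr (Or.inr ⟨not_le.mp hcB, h⟩)

/-- On a two-block window every candidate gap met is `≤ 2g`. -/
theorem gapLE (hW : TwoBlockWindow F lo B hi g) :
    ∀ (x : ℕ → K) (n : ℕ) (s : K), InWindow F lo hi x n s → GapLE F (2 * g) x n s := by
  intro x n
  induction n generalizing x with
  | zero => intro s _; trivial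
  | succ n ih =>
    rintro s ⟨⟨h1, h2⟩, hwu, hwd⟩
    refine ⟨?_, ih _ _ hwu, ih _ _ hwd⟩
    have hg := hW.pos
    by_cases hcB : clamp F (s + x 0) ≤ B
    · rcases hW.fine.roundUp_eq_or h1 hcB with h | h <;> rw [h] <;> linarith
    · rcases hW.coarse.roundUp_eq_or (not_le.mp hcB).le h2 with h | h <;> rw [h] <;> linarith

/-- **The step formula.**  With `N + 1` random bits the one-step mean at a window point `c` is
`τ(c) = c − ((c − lo) mod ρ(c))`, `ρ(c) = g/2^{N+1}` at or below `B` and `g/2^N` above it: the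
lower candidate lies on `lo + g·ℤ` and both sub-quanta divide `g`. -/
theorem stepQA_eq (hW : TwoBlockWindow F lo B hi g) (hlo : 0 ≤ lo) (N : ℕ) {c : K} (h1 : lo ≤ c)
    (h2 : c ≤ hi) :
    stepQ F (probAwayA (N + 1)) c (fun y => y)
      = c - resid (c - lo) (if c ≤ B then g / 2 ^ (N + 1) else g / 2 ^ N) := by
  have hc := hW.inHull h1 h2
  obtain ⟨hdF, -, hlod, -, hdc, -⟩ := hW.cand h1 h2
  have hd0 : 0 ≤ dn F c := hlo.trans hlod
  have hm := hW.grid _ hdF hlod (hdc.trans h2)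
  set m : ℤ := ⌊(dn F c - lo) / g⌋
  -- common finish: sub-quantum `ρ'`, `g = j·ρ'`, cell degenerate or of width `2^(N+1)·ρ'`
  have key : ∀ ρ' : K, 0 < ρ' → ∀ j : ℤ, g = j * ρ' →
      (up F c = dn F c ∨ up F c = dn F c + 2 ^ (N + 1) * ρ') →
      stepQ F (probAwayA (N + 1)) c (fun y => y) = c - resid (c - lo) ρ' := by
    intro ρ' hρ' j hj hw
    rw [stepQA_cell F (N + 1) hc hd0 hρ' hw]
    have e : c - dn F c = (c - lo) + ((-(m * j) : ℤ) : K) * ρ' := by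
      push_cast; linear_combination (-1 : K) * hm - (m : K) * hj
    rw [e, resid_add_mul hρ']
  have hg := hW.pos
  rcases hW.up_eq_or h1 h2 with h0 | ⟨hcB, hg1⟩ | ⟨hcB, hg2⟩
  · -- degenerate cell: either sub-quantum works
    split_ifs with hcB
    · exact key _ (by positivity) (2 ^ (N + 1)) (by push_cast; field_simp) (Or.inl h0)
    · exact key _ (by positivity) (2 ^ N) (by push_cast; field_simp) (Or.inl h0)
  · rw [if_pos hcB]
    refine key _ (by positivity) (2 ^ (N + 1)) (by push_cast; field_simp) (Or.inr ?_)
    rw [hg1]; field_simp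
  · rw [if_neg (not_le.mpr hcB)]
    refine key _ (by positivity) (2 ^ N) (by push_cast; field_simp) (Or.inr ?_)
    rw [hg2]; field_simp; ring

/-- **The lever.**  Between window points one grid step class apart (`c' − c ∈ g·ℤ`, `c ≤ c'`) the
one-step mean of StochasticA (`N + 1` bits) is monotone and `1`-Lipschitz:
`0 ≤ τ(c') − τ(c) ≤ c' − c` — the truncated residue of a given offset can only GROW when read in the
coarser block (`y mod ρ ≤ y mod 2ρ ≤ y mod ρ + ρ ≤ y mod ρ + g`). -/
theorem stepQA_lever (hW : TwoBlockWindow F lo B hi g) (hlo : 0 ≤ lo) (N : ℕ) {c c' : K}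
    (h1 : lo ≤ c) (hcc : c ≤ c') (h2 : c' ≤ hi) {k : ℤ} (hk : c' - c = k * g) :
    stepQ F (probAwayA (N + 1)) c (fun y => y) ≤ stepQ F (probAwayA (N + 1)) c' (fun y => y) ∧
      stepQ F (probAwayA (N + 1)) c' (fun y => y) - stepQ F (probAwayA (N + 1)) c (fun y => y)
        ≤ c' - c := by
  rw [hW.stepQA_eq hlo N h1 (hcc.trans h2), hW.stepQA_eq hlo N (h1.trans hcc) h2]
  have hg := hW.pos
  set ρ : K := g / 2 ^ (N + 1) with hρdef
  have hρ : 0 < ρ := by positivity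
  have hρ0 : ρ ≠ 0 := hρ.ne'
  have hgρ : g = 2 ^ (N + 1) * ρ := by rw [hρdef]; field_simp
  have h2ρ : g / 2 ^ N = 2 * ρ := by rw [hρdef]; field_simp; ring
  rw [h2ρ]
  by_cases hc'B : c' ≤ B
  · rw [if_pos (hcc.trans hc'B), if_pos hc'B]
    have e : c' - lo = (c - lo) + ((k * 2 ^ (N + 1) : ℤ) : K) * ρ := by
      push_cast; linear_combination hk + (k : K) * hgρ
    rw [e, resid_add_mul hρ]; constructor <;> linarith
  · rw [if_neg hc'B]
    have e : c' - lo = (c - lo) + ((k * 2 ^ N : ℤ) : K) * (2 * ρ) := by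
      push_cast; linear_combination hk + (k : K) * hgρ
    rw [e, resid_add_mul (by positivity : (0 : K) < 2 * ρ)]
    by_cases hcB : c ≤ B
    · rw [if_pos hcB]
      have hk1 : (1 : K) ≤ k := by
        have h0 : (0 : K) < (k : K) * g := by rw [← hk]; linarith [lt_of_le_of_lt hcB (not_le.mp hc'B)]
        have hk0 : (0 : ℤ) < k := by exact_mod_cast (mul_pos_iff_of_pos_right hg).mp h0
        exact_mod_cast (show (1 : ℤ) ≤ k by omega)
      have hkg : g ≤ c' - c := by rw [hk]; exact le_mul_of_one_le_left hg.le hk1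
      have hρg : ρ ≤ g := by
        rw [hgρ]; exact le_mul_of_one_le_left hρ.le (by exact_mod_cast Nat.one_le_two_pow)
      obtain ⟨lo1, hi1⟩ := resid_two_mul hρ (y := c - lo)
      constructor <;> linarith
    · rw [if_neg hcB]; constructor <;> linarith

omit [IsStrictOrderedRing K] in
/-- Cells of a finite value set: if `c ≤ c'` and the lower candidate of `c'` is below the upper
candidate of `c`, the two points share their cell. -/
theorem cell_eq (hW : TwoBlockWindow F lo B hi g) {c c' : K} (h1 : lo ≤ c) (hcc : c ≤ c')
    (h2 : c' ≤ hi) (hlt : dn F c' < up F c) : dn F c' = dn F c ∧ up F c' = up F c := by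
  obtain ⟨hdF, huF, -, -, hdc, -⟩ := hW.cand h1 (hcc.trans h2)
  obtain ⟨hdF', huF', -, -, -, hcu'⟩ := hW.cand (h1.trans hcc) h2
  exact ⟨le_antisymm (le_dn_of_lt_up hdF' hlt) (le_dn_of_mem hdF (hdc.trans hcc)),
    le_antisymm (up_le_of_dn_lt huF hlt) (up_le_of_mem huF' (hcc.trans hcu'))⟩

/-- **Contraction of the mean map.**  On a two-block window (`0 ≤ lo`) the `n`-step mean of
StochasticA with `N + 1` bits is `1`-Lipschitz on window grid points:
`E[ŝₙ | ŝₖ = t'] − E[ŝₙ | ŝₖ = t] ≤ t' − t` for `t ≤ t'` in `F ∩ [lo, hi]` (trees from `t`, `t'`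
unsaturated and inside the window).  Induction: the step mean is a convex combination read at
`τ(c)`, and the lever moves `τ` monotonically by at most `c' − c`. -/
theorem accExpQA_contract (hW : TwoBlockWindow F lo B hi g) (hlo : 0 ≤ lo) (N : ℕ) :
    ∀ (x : ℕ → K) (n : ℕ) (t t' : K), t ∈ F → t' ∈ F → lo ≤ t → t' ≤ hi → t ≤ t' →
      NoSat F x n t → InWindow F lo hi x n t → NoSat F x n t' → InWindow F lo hi x n t' →
      accExpQ F (probAwayA (N + 1)) x n (fun y => y) t'
        - accExpQ F (probAwayA (N + 1)) x n (fun y => y) t ≤ t' - t := by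
  intro x n
  induction n generalizing x with
  | zero => intro t t' _ _ _ _ _ _ _ _ _; simp [accExpQ]
  | succ n ih =>
    rintro t t' ht ht' hlt hth htt ⟨hin, hnu, hnd⟩ ⟨⟨h1, h2⟩, hwu, hwd⟩ ⟨hin', hnu', hnd'⟩
      ⟨⟨h1', h2'⟩, hwu', hwd'⟩
    rw [clamp_eq_self hin] at h1 h2
    rw [clamp_eq_self hin'] at h1' h2'
    have hcc : t + x 0 ≤ t' + x 0 := by linarith
    -- the lever, with `c' − c = t' − t ∈ g·ℤ`
    have hm := hW.grid t ht hlt (htt.trans hth)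
    have hm' := hW.grid t' ht' (hlt.trans htt) hth
    have hk : (t' + x 0) - (t + x 0) = ((⌊(t' - lo) / g⌋ - ⌊(t - lo) / g⌋ : ℤ) : K) * g := by
      push_cast; linear_combination hm' - hm
    obtain ⟨hτ1, hτ2⟩ := hW.stepQA_lever hlo N h1 hcc h2' hk
    simp only [stepQ] at hτ1 hτ2
    obtain ⟨hdF, huF, hlod, huhi, hdc, hcu⟩ := hW.cand h1 h2
    obtain ⟨hdF', huF', hlod', huhi', hdc', hcu'⟩ := hW.cand h1' h2'
    obtain ⟨hp0, hp1⟩ := pUpQ_mem F (probAwayA_mem (N + 1)) (t + x 0)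
    obtain ⟨hp0', hp1'⟩ := pUpQ_mem F (probAwayA_mem (N + 1)) (t' + x 0)
    set q := probAwayA (K := K) (N + 1)
    set x' : ℕ → K := fun i => x (i + 1)
    have IH1 := ih x' (dn F (t + x 0)) (up F (t + x 0)) hdF huF hlod huhi (hdc.trans hcu) hnd hwd hnu hwu
    have IH2 := ih x' (dn F (t' + x 0)) (up F (t' + x 0)) hdF' huF' hlod' huhi' (hdc'.trans hcu')
      hnd' hwd' hnu' hwu'
    show stepQ F q (t' + x 0) (accExpQ F q x' n fun y => y)
        - stepQ F q (t + x 0) (accExpQ F q x' n fun y => y) ≤ t' - t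
    simp only [stepQ]
    by_cases hsep : up F (t + x 0) ≤ dn F (t' + x 0)
    · have IH3 := ih x' (up F (t + x 0)) (dn F (t' + x 0)) huF hdF' (h1.trans hcu) (hdc'.trans h2')
        hsep hnu hwu hnd' hwd'
      set p := pUpQ F q (t + x 0)
      set p' := pUpQ F q (t' + x 0)
      have e1 := mul_le_mul_of_nonneg_left IH2 hp0'
      have e2 := mul_le_mul_of_nonneg_left IH1 (sub_nonneg.mpr hp1)
      linarith [e1, e2, IH3, hτ2]
    · obtain ⟨hdd, huu⟩ := hW.cell_eq h1 hcc h2' (not_le.mp hsep)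
      rw [hdd, huu] at hτ1 hτ2 ⊢
      set p := pUpQ F q (t + x 0)
      set p' := pUpQ F q (t' + x 0)
      rcases eq_or_lt_of_le (hdc.trans hcu) with hdu | hdu
      · rw [hdu]; linarith [htt]
      · have hpp : 0 ≤ p' - p :=
          (mul_nonneg_iff_of_pos_right (sub_pos.mpr hdu)).mp (by linarith [hτ1])
        have e1 := mul_le_mul_of_nonneg_left IH1 hpp
        linarith [e1, hτ2]

/-- **StochasticA trees are drift-antitone across a binade boundary** (`N + 1 ≥ 1` random bits,
one-signed two-block window, no saturation). -/
theorem driftAntitone_stochasticA (hW : TwoBlockWindow F lo B hi g) (hlo : 0 ≤ lo) (N : ℕ) :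
    ∀ (x : ℕ → K) (n : ℕ) (s : K), NoSat F x n s → InWindow F lo hi x n s →
      DriftAntitone F (probAwayA (N + 1)) x n s := by
  intro x n
  induction n generalizing x with
  | zero => intro s _ _; trivial
  | succ n ih =>
    rintro s ⟨hin, hnu, hnd⟩ ⟨⟨h1, h2⟩, hwu, hwd⟩
    refine ⟨?_, ih _ _ hnu hwu, ih _ _ hnd hwd⟩
    rw [clamp_eq_self hin] at h1 h2
    obtain ⟨hdF, huF, hlod, huhi, hdc, hcu⟩ := hW.cand h1 h2
    have := hW.accExpQA_contract hlo N (fun i => x (i + 1)) n (dn F (s + x 0)) (up F (s + x 0)) hdF huF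
      hlod huhi (hdc.trans hcu) hnd hwd hnu hwu
    linarith

/-- **MSE of StochasticA across a binade boundary, every `n`.**  On a one-signed two-block window
(spacings `g`, `2g`), StochasticA with `N + 1` random bits obeys the Pythagorean law with `G = 2g`,
`ε = 2^{-(N+1)}`: `E(ŝₙ − sₙ)² ≤ n·(2g)²/4 + (n·2^{-(N+1)}·2g)²` (file XCII's theorem + item above). -/
theorem stochasticA_acc_sq_le (hW : TwoBlockWindow F lo B hi g) (hlo : 0 ≤ lo) (N : ℕ) (x : ℕ → K)
    (n : ℕ) (s : K) (hns : NoSat F x n s) (hw : InWindow F lo hi x n s) :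
    accExpQ F (probAwayA (N + 1)) x n (fun t => (t - (s + ∑ i ∈ range n, x i)) ^ 2) s
      ≤ n * ((2 * g) ^ 2 / 4) + (n * (1 / 2 ^ (N + 1) * (2 * g))) ^ 2 :=
  accExpQ_sq_le_of_driftAntitone F (probAwayA_mem (N + 1)) (fun η _ _ => abs_probAwayA_sub_le (N + 1) η)
    x n s hns (hW.gapLE x n s hw) (hW.driftAntitone_stochasticA hlo N x n s hns hw)

end TwoBlockWindow

end LimitedBits

namespace Formats

open LimitedBits

/-- The E3M2 window `[6, 14]` = `{6, 7, 8} ∪ {8, 10, 12, 14}` is a two-block window (`g = 1`, `B = 8`). -/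
theorem e3m2_twoBlock_6_8_14 : TwoBlockWindow e3m2 6 8 14 1 :=
  ⟨⟨by decide +kernel, by decide +kernel, by norm_num, by decide +kernel, by decide +kernel⟩,
    ⟨by decide +kernel, by decide +kernel, by norm_num, by decide +kernel, by decide +kernel⟩,
    by decide +kernel⟩

/-- **StochasticA law on `[6, 14]` ⊂ E3M2 for every `n` and every `N + 1 ≥ 1` random bits**
(`G = 2`, `ε = 2^{-(N+1)}`) — the window on which StochasticB with one bit breaks the law at `n = 4`
(file XCII, `e3m2_pyth_fails_stochasticB1`). -/
theorem e3m2_stochasticA_binade_law (N : ℕ) (x : ℕ → ℚ) (n : ℕ) (s : ℚ) (hns : NoSat e3m2 x n s)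
    (hw : InWindow e3m2 6 14 x n s) :
    accExpQ e3m2 (probAwayA (N + 1)) x n (fun t => (t - (s + ∑ i ∈ range n, x i)) ^ 2) s
      ≤ n * ((2 : ℚ) ^ 2 / 4) + (n * (1 / 2 ^ (N + 1) * 2)) ^ 2 :=
  (e3m2_twoBlock_6_8_14.stochasticA_acc_sq_le (by norm_num) N x n s hns hw).trans (le_of_eq (by ring))

/-- **Kernel-level dichotomy between the P3109 variants at the first binade boundary**: on the
one-signed E3M2 window `[6, 14]`, StochasticA obeys `E(ŝₙ − sₙ)² ≤ n·G²/4 + (n·ε·G)²` for every `n`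
and every number `N + 1` of random bits, while StochasticB with one random bit (`ε = 1/4`) exceeds it
after four additions (`129/16 > 8`). -/
theorem e3m2_binade_dichotomy :
    (∀ (N : ℕ) (x : ℕ → ℚ) (n : ℕ) (s : ℚ), NoSat e3m2 x n s → InWindow e3m2 6 14 x n s →
      accExpQ e3m2 (probAwayA (N + 1)) x n (fun t => (t - (s + ∑ i ∈ range n, x i)) ^ 2) s
        ≤ n * ((2 : ℚ) ^ 2 / 4) + (n * (1 / 2 ^ (N + 1) * 2)) ^ 2) ∧
    (NoSat e3m2 xW2 4 6 ∧ InWindow e3m2 6 14 xW2 4 6 ∧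
      (4 : ℚ) * (2 ^ 2 / 4) + (4 * (1 / 2 ^ (1 + 1) * 2)) ^ 2
        < accExpQ e3m2 (probAwayB 1) xW2 4 (fun t => (t - 8) ^ 2) 6) :=
  ⟨e3m2_stochasticA_binade_law, e3m2_pyth_fails_stochasticB1.1, e3m2_pyth_fails_stochasticB1.2.1, by
    rw [e3m2_pyth_fails_stochasticB1.2.2.2.1]; norm_num⟩

/-- The E2M3 window `[7/2, 13/2]` = `{7/2, 15/4, 4} ∪ {4, 9/2, …, 13/2}` is a two-block window
(`g = 1/4`, `B = 4`). -/
theorem e2m3_twoBlock : TwoBlockWindow e2m3 (7 / 2) 4 (13 / 2) (1 / 4) :=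
  ⟨⟨by decide +kernel, by decide +kernel, by norm_num, by decide +kernel, by decide +kernel⟩,
    ⟨by decide +kernel, by decide +kernel, by norm_num, by decide +kernel, by decide +kernel⟩,
    by decide +kernel⟩

/-- **StochasticA law on `[7/2, 13/2]` ⊂ E2M3 for every `n`** (`G = 1/2`, `ε = 2^{-(N+1)}`) — the
window on which `SR_{1/4}` of [XiaEtAl2022] breaks the law at `n = 6` (XCII `e2m3_pyth_fails_srEps`);
with `N + 1 = 2` bits StochasticA has the same `ε = 1/4`. -/
theorem e2m3_stochasticA_binade_law (N : ℕ) (x : ℕ → ℚ) (n : ℕ) (s : ℚ) (hns : NoSat e2m3 x n s)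
    (hw : InWindow e2m3 (7 / 2) (13 / 2) x n s) :
    accExpQ e2m3 (probAwayA (N + 1)) x n (fun t => (t - (s + ∑ i ∈ range n, x i)) ^ 2) s
      ≤ n * (((1 : ℚ) / 2) ^ 2 / 4) + (n * (1 / 2 ^ (N + 1) * (1 / 2))) ^ 2 :=
  (e2m3_twoBlock.stochasticA_acc_sq_le (by norm_num) N x n s hns hw).trans (le_of_eq (by ring))

/-- **Scope: one boundary.**  Across TWO boundaries one random bit is not enough for antitonicity:
on the E3M2 window `[7/4, 5]` (spacings `1/4, 1/2, 1`), from `3` with summands `−9/8, 5/2`, the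
StochasticA tree with one bit is NOT drift-antitone (two bits: it is) — though the law itself still
holds there (`13/64 ≤ 3/2`; sr-seat certificate gen16/pyth, evidence for the three-block case). -/
theorem e3m2_threeBinade_A1_not :
    NoSat e3m2 (seqL [-9 / 8, 5 / 2]) 2 3 ∧ InWindow e3m2 (7 / 4) 5 (seqL [-9 / 8, 5 / 2]) 2 3 ∧
      ¬ DriftAntitone e3m2 (probAwayA 1) (seqL [-9 / 8, 5 / 2]) 2 3 ∧
      DriftAntitone e3m2 (probAwayA 2) (seqL [-9 / 8, 5 / 2]) 2 3 ∧
      accExpQ e3m2 (probAwayA 1) (seqL [-9 / 8, 5 / 2]) 2 (fun t => (t - 35 / 8) ^ 2) 3 = 13 / 64 := by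
  refine ⟨?_, ?_, ?_, ?_, by decide +kernel⟩
  · rw [← noSatB_iff]; decide +kernel
  · rw [← inWindowB_iff]; decide +kernel
  · rw [← driftAntitoneB_iff]; decide +kernel
  · rw [← driftAntitoneB_iff]; decide +kernel

end Formats

end Summit.Ventures.CertifiedArithmetic.LowPrec.SR
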